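import Summits.BirchSwinnertonDyer.BirchSwinnertonDyer.Theses.UniversalToricDescent
import HarnessLib

/-!
# Route `UniversalToricDescent` — glue item `ToricPublishedInputsGlue`
# (stmt-BirchSwinnertonDyer-20429): pure logic

Seat `bsd-potss-kmc`, gen 18 (cell `bsd-potss`; kernel service on route `UniversalToricDescent`,
rev 11). The six named-fact leaves and the parametrised conjunction reassemble the support
`ToricPublishedInputs` (`And.intro` in the item's order; vet-utd's candidate `ProofUTD.lean`).
HONEST FRAMING: pure logic; every leaf stays a cite-level named fact; BSD is not advanced by this.

References: [GrossZagier1986] Thm. I.(6.3); [Kolyvagin1990] Thm. A.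
-/

set_option linter.dupNamespace false

namespace Summit.BirchSwinnertonDyer.BirchSwinnertonDyer.Theorems

open Summit.BirchSwinnertonDyer.BirchSwinnertonDyer.Theses.UniversalToricDescent

/-- **Glue `ToricPublishedInputsGlue` (item 20429) holds**: `RankEqAnalyticRankLeOne →
EntireLFunctionRat → ModularParametrizationSupply → BSDQuotientIsogenyInvariance →
GrossZagierRationalPointI73 → FriedbergHoffsteinHeegnerSplitDivisorsTwist → ToricParametrisedInputs
→ ToricPublishedInputs` by reordering conjuncts. [cite: GrossZagier1986, Thm. I.(6.3)] -/
theorem toricPublishedInputsGlue_proof : ToricPublishedInputsGlue := by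
  unfold ToricPublishedInputsGlue
  intro h1 h2 h3 h4 h5 h6 h7
  exact ⟨h7.1, h7.2.1, h1, h2, h3, h4, h5, h6, h7.2.2.1, h7.2.2.2⟩

end Summit.BirchSwinnertonDyer.BirchSwinnertonDyer.Theorems
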